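import Mathlib
import Literature.LinearAlgebra.Matrix.PosSemidefTrace

/-!
# Domination inequality: generalised condensation from local condensation

(Solo paper §13.8, Proposition 13.9, step (2), operator half; finite-dimensional one-particle space.)

Let `γ ⪰ 0` be a one-particle density matrix (`Re Tr γ = N`), `P` an orthogonal projection (onto the
box constants `u_B`), `Q` an operator with `0 ≤ Q ≤ 1` (the momentum cutoff `Π_{|p|>k₀}`), and suppose
the symbol bound `P Q P ≤ m·1`. Then

* `re_trace_mul_le_two_blocks` — operator Cauchy–Schwarz `Q ≤ 2(1−P)Q(1−P) + 2PQP`, in trace form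
  (`(1−2P)Q(1−2P) ⪰ 0` expands to exactly the difference);
* `re_trace_exc_block_le` — `Re Tr(γ(1−P)Q(1−P)) ≤ Re Tr(γ(1−P))` (uses `Q ≤ 1`, `P² = P`);
* `re_trace_cond_block_le` — `Re Tr(γPQP) ≤ m·Re Tr γ`;
* `re_trace_cutoff_le` — **domination**: `Re Tr(γQ) ≤ 2·Re Tr(γ(1−P)) + 2m·Re Tr γ`;
* `generalised_condensation_of_local` — with `Re Tr γ = N` and local condensation deficit
  `Re Tr(γ(1−P)) ≤ sN`: `Re Tr(γ(1−Q)) ≥ (1 − 2s − 2m)N`.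

Together with the kernel-checked symbol bound `m ≤ 24√3/(πk₀R)` (`SoloBlindBoxLatticeSymbol3D`)
this is step (2) of Prop. 13.9 modulo the localisation input (1) and the identification of
`‖PΠ_{|p|>k₀}P‖` with the lattice symbol.
-/

open Matrix
open scoped ComplexOrder MatrixOrder

namespace Summit.AtomisticToContinuum.BoseEinsteinCondensation.Theorems

variable {n : Type*} [Fintype n] [DecidableEq n]

/-- Monotonicity of `Z ↦ Re Tr(γZ)` for `γ ⪰ 0`: `Z₂ − Z₁ ⪰ 0 ⟹ Re Tr(γZ₁) ≤ Re Tr(γZ₂)`. -/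
theorem re_trace_mul_mono {γ Z₁ Z₂ : Matrix n n ℂ} (hγ : γ.PosSemidef)
    (h : (Z₂ - Z₁).PosSemidef) : (γ * Z₁).trace.re ≤ (γ * Z₂).trace.re := by
  have h0 := Literature.LinearAlgebra.Matrix.re_trace_mul_nonneg_of_posSemidef hγ h
  rw [Matrix.mul_sub, trace_sub, Complex.sub_re] at h0
  linarith

/-- **Operator Cauchy–Schwarz** in trace form: for `γ, Q ⪰ 0` and `P` Hermitian,
`Re Tr(γQ) ≤ 2·Re Tr(γ(1−P)Q(1−P)) + 2·Re Tr(γPQP)` — since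
`2(1−P)Q(1−P) + 2PQP − Q = (1−2P)Q(1−2P) ⪰ 0`. -/
theorem re_trace_mul_le_two_blocks {γ Q P : Matrix n n ℂ} (hγ : γ.PosSemidef)
    (hQ : Q.PosSemidef) (hP : P.IsHermitian) :
    (γ * Q).trace.re
      ≤ 2 * (γ * ((1 - P) * Q * (1 - P))).trace.re + 2 * (γ * (P * Q * P)).trace.re := by
  have hpsd : ((1 - P - P)ᴴ * Q * (1 - P - P)).PosSemidef :=
    hQ.conjTranspose_mul_mul_same (1 - P - P)
  have hH : (1 - P - P)ᴴ = 1 - P - P := by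
    rw [conjTranspose_sub, conjTranspose_sub, conjTranspose_one, hP.eq]
  have hid : (1 - P - P) * Q * (1 - P - P)
      = ((1 - P) * Q * (1 - P) + (1 - P) * Q * (1 - P)) + (P * Q * P + P * Q * P) - Q := by
    noncomm_ring
  rw [hH, hid] at hpsd
  have h0 := Literature.LinearAlgebra.Matrix.re_trace_mul_nonneg_of_posSemidef hγ hpsd
  rw [Matrix.mul_sub, Matrix.mul_add, Matrix.mul_add, Matrix.mul_add] at h0
  simp only [trace_sub, trace_add, Complex.sub_re, Complex.add_re] at h0
  linarith

/-- The excited block is controlled by local condensation: for `γ ⪰ 0`, `Q ≤ 1` and `P` an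
orthogonal projection, `Re Tr(γ(1−P)Q(1−P)) ≤ Re Tr(γ(1−P))`. -/
theorem re_trace_exc_block_le {γ Q P : Matrix n n ℂ} (hγ : γ.PosSemidef)
    (hQ1 : (1 - Q).PosSemidef) (hP : P.IsHermitian) (hPP : P * P = P) :
    (γ * ((1 - P) * Q * (1 - P))).trace.re ≤ (γ * (1 - P)).trace.re := by
  have hpsd : ((1 - P)ᴴ * (1 - Q) * (1 - P)).PosSemidef := hQ1.conjTranspose_mul_mul_same (1 - P)
  have hH : (1 - P)ᴴ = 1 - P := by rw [conjTranspose_sub, conjTranspose_one, hP.eq]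
  have hid : (1 - P) * (1 - Q) * (1 - P) = (1 - P - P + P * P) - (1 - P) * Q * (1 - P) := by
    noncomm_ring
  rw [hH, hid, hPP, sub_add_cancel] at hpsd
  exact re_trace_mul_mono hγ hpsd

/-- The condensed block is controlled by the symbol bound `PQP ≤ m·1`:
`Re Tr(γPQP) ≤ m·Re Tr γ`. -/
theorem re_trace_cond_block_le {γ Q P : Matrix n n ℂ} (hγ : γ.PosSemidef) {m : ℝ}
    (hm : ((m : ℂ) • (1 : Matrix n n ℂ) - P * Q * P).PosSemidef) :
    (γ * (P * Q * P)).trace.re ≤ m * γ.trace.re := by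
  have h := re_trace_mul_mono hγ hm
  rw [Matrix.mul_smul, Matrix.mul_one, trace_smul, smul_eq_mul, Complex.re_ofReal_mul] at h
  exact h

/-- **Domination inequality** (Prop. 13.9 step (2), operator half): for `γ ⪰ 0`, `0 ≤ Q ≤ 1`,
`P` an orthogonal projection and `PQP ≤ m·1`,
`Re Tr(γQ) ≤ 2·Re Tr(γ(1−P)) + 2m·Re Tr γ`. -/
theorem re_trace_cutoff_le {γ Q P : Matrix n n ℂ} (hγ : γ.PosSemidef) (hQ : Q.PosSemidef)
    (hQ1 : (1 - Q).PosSemidef) (hP : P.IsHermitian) (hPP : P * P = P) {m : ℝ}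
    (hm : ((m : ℂ) • (1 : Matrix n n ℂ) - P * Q * P).PosSemidef) :
    (γ * Q).trace.re ≤ 2 * (γ * (1 - P)).trace.re + 2 * m * γ.trace.re := by
  have h1 := re_trace_mul_le_two_blocks hγ hQ hP
  have h2 := re_trace_exc_block_le hγ hQ1 hP hPP
  have h3 := re_trace_cond_block_le (Q := Q) (P := P) hγ hm
  have h3' : 2 * (γ * (P * Q * P)).trace.re ≤ 2 * m * γ.trace.re := by linarith
  linarith

/-- **Generalised condensation from local condensation.** If `Re Tr γ = N`, the local
condensation deficit is `Re Tr(γ(1−P)) ≤ sN` and the symbol bound `PQP ≤ m·1` holds, then the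
occupation of the complement of the cutoff satisfies `Re Tr(γ(1−Q)) ≥ (1 − 2s − 2m)N`. -/
theorem generalised_condensation_of_local {γ Q P : Matrix n n ℂ} (hγ : γ.PosSemidef)
    (hQ : Q.PosSemidef) (hQ1 : (1 - Q).PosSemidef) (hP : P.IsHermitian) (hPP : P * P = P)
    {m s N : ℝ} (hN : γ.trace.re = N) (hs : (γ * (1 - P)).trace.re ≤ s * N)
    (hm : ((m : ℂ) • (1 : Matrix n n ℂ) - P * Q * P).PosSemidef) :
    (1 - 2 * s - 2 * m) * N ≤ (γ * (1 - Q)).trace.re := by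
  have h := re_trace_cutoff_le hγ hQ hQ1 hP hPP hm
  rw [hN] at h
  rw [Matrix.mul_sub, Matrix.mul_one, trace_sub, Complex.sub_re, hN]
  have e : (1 - 2 * s - 2 * m) * N = N - 2 * (s * N) - 2 * m * N := by ring
  rw [e]
  linarith

end Summit.AtomisticToContinuum.BoseEinsteinCondensation.Theorems
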